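import Summits.Ventures.PercRepro.OrbitK

/-!
# PercRepro — C-025 «RANK LEVEL-SET INEQUALITY»: Lemma E, `Φ(p+1, q+1) < Φ(p, q)` (p3, gen 6)

`Φ(p, q) = Σ_{q<u<p} C(p+q, u) / C(p+q, p)` is typer-2's `phiK` (`OrbitK.lean`). Mine-2's Lemma E
(`proofs/MINE2-RLS.md` §0) is the termwise strict inequality
`C(p+q+2, u+1)/C(p+q+2, p+1) < C(p+q, u)/C(p+q, p)` for `q < u < p`, hence `Φ(p+1, q+1) < Φ(p, q)` when
`q + 2 ≤ p` — the monotonicity that lets the reduction to simple matroids (Theorem D, §4) iterate `Lemma E`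
along a contraction `N/Q` of rank `a`: `Φ(p−a, q−a) ≥ Φ(p, q)`.

* `choose_succ_succ_mul` — `C(n+2, u+1)·(u+1)·(n+1−u) = C(n,u)·(n+1)·(n+2)` (two Mathlib identities);
* `succ_mul_succ_lt` — `(p+1)(q+1) < (u+1)(p+q+1−u)` for `q < u < p` (the difference is `(u−q)(p−u)`);
* `choose_ratio_succ_lt` — the termwise inequality (cross-multiplied in `ℕ`, then `div_lt_div_iff₀`);
* **`phiK_succ_succ_lt`** — Lemma E: `phiK (p + 1) (q + 1) < phiK p q` for `q + 2 ≤ p`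
  (for `p ≤ q + 1` both sides are `0`, so the hypothesis is needed).
Axioms: standard.
-/

namespace PercRepro

/-- The binomial identity `C(n+2, u+1)·(u+1)·(n+1−u) = C(n,u)·(n+1)·(n+2)` for `u ≤ n`
(Mathlib's `Nat.add_one_mul_choose_eq` and `Nat.choose_mul_succ_eq`). -/
lemma choose_succ_succ_mul (n u : ℕ) :
    (n + 2).choose (u + 1) * (u + 1) * (n + 1 - u) = n.choose u * (n + 1) * (n + 2) := by
  have h1 : (n + 2) * (n + 1).choose u = (n + 2).choose (u + 1) * (u + 1) :=
    Nat.add_one_mul_choose_eq (n + 1) u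
  have h2 : n.choose u * (n + 1) = (n + 1).choose u * (n + 1 - u) := Nat.choose_mul_succ_eq n u
  calc (n + 2).choose (u + 1) * (u + 1) * (n + 1 - u)
      = ((n + 2) * (n + 1).choose u) * (n + 1 - u) := by rw [h1]
    _ = (n + 2) * ((n + 1).choose u * (n + 1 - u)) := by ring
    _ = (n + 2) * (n.choose u * (n + 1)) := by rw [h2]
    _ = n.choose u * (n + 1) * (n + 2) := by ring

/-- `(p+1)(q+1) < (u+1)(p+q+1−u)` for `q < u < p` (the difference is `(u−q)(p−u)`). -/
lemma succ_mul_succ_lt {p q u : ℕ} (hqu : q < u) (hup : u < p) :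
    (p + 1) * (q + 1) < (u + 1) * (p + q + 1 - u) := by
  obtain ⟨s, rfl⟩ := Nat.exists_eq_add_of_lt hqu
  obtain ⟨t, rfl⟩ := Nat.exists_eq_add_of_lt hup
  have h : q + s + 1 + t + 1 + q + 1 - (q + s + 1) = q + t + 2 := by omega
  rw [h]
  nlinarith [Nat.zero_le (s * t), Nat.zero_le s, Nat.zero_le t]

/-- **Lemma E, termwise** (mine-2, MINE2-RLS.md §0): for `q < u < p`,
`C(p+q+2, u+1) / C(p+q+2, p+1) < C(p+q, u) / C(p+q, p)`. -/
lemma choose_ratio_succ_lt {p q u : ℕ} (hqu : q < u) (hup : u < p) :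
    ((p + q + 2).choose (u + 1) : ℚ) / ((p + q + 2).choose (p + 1) : ℚ) <
      ((p + q).choose u : ℚ) / ((p + q).choose p : ℚ) := by
  have hun : u ≤ p + q := by omega
  have hpn : p ≤ p + q := by omega
  have hA := choose_succ_succ_mul (p + q) u
  have hB := choose_succ_succ_mul (p + q) p
  have hnp : p + q + 1 - p = q + 1 := by omega
  rw [hnp] at hB
  have ha : 0 < (p + q).choose u := Nat.choose_pos hun
  have hb : 0 < (p + q).choose p := Nat.choose_pos hpn
  have hB' : 0 < (p + q + 2).choose (p + 1) := Nat.choose_pos (by omega)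
  have hkey := succ_mul_succ_lt hqu hup
  have hc : 0 < p + q + 1 - u := by omega
  -- the ℕ inequality `A · b < a · B`, after multiplying by the positive `K`
  have hmain : (p + q + 2).choose (u + 1) * (p + q).choose p <
      (p + q).choose u * (p + q + 2).choose (p + 1) := by
    have hK : 0 < (u + 1) * (p + q + 1 - u) * ((p + 1) * (q + 1)) := by positivity
    refine Nat.lt_of_mul_lt_mul_right (a := (u + 1) * (p + q + 1 - u) * ((p + 1) * (q + 1))) ?_
    calc (p + q + 2).choose (u + 1) * (p + q).choose p *
          ((u + 1) * (p + q + 1 - u) * ((p + 1) * (q + 1)))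
        = ((p + q + 2).choose (u + 1) * (u + 1) * (p + q + 1 - u)) *
            ((p + q).choose p * ((p + 1) * (q + 1))) := by ring
      _ = ((p + q).choose u * (p + q + 1) * (p + q + 2)) *
            ((p + q).choose p * ((p + 1) * (q + 1))) := by rw [hA]
      _ < ((p + q).choose u * (p + q + 1) * (p + q + 2)) *
            ((p + q).choose p * ((u + 1) * (p + q + 1 - u))) := by
          apply Nat.mul_lt_mul_of_pos_left _ (by positivity)
          exact Nat.mul_lt_mul_of_pos_left hkey hb
      _ = (p + q).choose u * ((p + q + 2).choose (p + 1) * (p + 1) * (q + 1)) *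
            ((u + 1) * (p + q + 1 - u)) := by rw [hB]; ring
      _ = (p + q).choose u * (p + q + 2).choose (p + 1) *
            ((u + 1) * (p + q + 1 - u) * ((p + 1) * (q + 1))) := by ring
  rw [div_lt_div_iff₀ (by exact_mod_cast hB') (by exact_mod_cast hb)]
  exact_mod_cast hmain

/-- **Lemma E** (mine-2, MINE2-RLS.md §0): `Φ(p+1, q+1) < Φ(p, q)` whenever `q + 2 ≤ p`
(for `p ≤ q + 1` both sides are `0`). -/
theorem phiK_succ_succ_lt {p q : ℕ} (hpq : q + 2 ≤ p) : phiK (p + 1) (q + 1) < phiK p q := by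
  unfold phiK
  rw [show p + 1 + (q + 1) = p + q + 2 by ring, Finset.sum_div, Finset.sum_div,
    ← Finset.image_add_right_Ioo q p 1,
    Finset.sum_image (fun _ _ _ _ h => by simpa using h)]
  refine Finset.sum_lt_sum_of_nonempty ⟨q + 1, by simp; omega⟩ (fun u hu => ?_)
  rw [Finset.mem_Ioo] at hu
  exact choose_ratio_succ_lt hu.1 hu.2

end PercRepro
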